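import Mathlib
import HarnessLib
import Summits.HubbardSuperconductivity.HubbardSuperconductivity.Theorems.KLProgrammeKLRegimeSplitPolarAngleDerivBounds
import Summits.HubbardSuperconductivity.HubbardSuperconductivity.Theorems.KLProgrammeKLRegimeCountertermPolarAngleRay
import Summits.HubbardSuperconductivity.HubbardSuperconductivity.Theorems.KLProgrammePerturbedFermiCurveCompChainStruct
import Summits.HubbardSuperconductivity.HubbardSuperconductivity.Theorems.KLProgrammeKLRegimeCountertermJacksonRemainderCertAngle

/-!
# (C1) ANALYTIC CERTIFICATE at deep scales, part 1 — the ROTATED ARGUMENT CHART and the near-field jets of the displaced polar angle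

Cell `gate-hubbard-kl`, seat hubbard-kl-k3c3-p3 (g12), `--supports stmt-HubbardSuperconductivity-20437` (stub (C) of `KLRegimeEngineV17F2`),
located item «(C1)-DEEP-AN» (KL STATUS 2026-08-27T23:50Z): the (C1) certificate `CutoffDefectCertFrame d A T` (k3c3-p1, `…CertFrameDefs`) is
to be proved ANALYTICALLY at every Jackson degree `d`, so that k3c3-p1's one-call door `readResidueC1_jets_of_certFrame` applies verbatim
at every reading scale.  Its near-field rows are the jets of the DISPLACED POLAR ANGLE `ϑ ↦ angle(r(ϑ)·dir ϑ − w)` at the base angle `θ`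
for displacements `‖w‖ ≤ δ`.

This file (pure planar calculus, carrier `Momentum = EuclideanSpace ℝ (Fin 2)`; no model objects):
* §1 the ROTATED ARGUMENT CHART `Ψ_θ(p) = θ + arg((p₀ + ip₁)·e^{−iθ})`: smooth on the open half-plane `p·dir θ > 0` (no branch cut there),
  `Ψ_θ(t·dir ϑ) = ϑ` for `t > 0`, `|ϑ − θ| < π`, and `‖D^{l+1}Ψ_θ(p)‖ ≤ l!/‖p‖^{l+1}` (k3c3-p1's `norm_iteratedFDeriv_arg_le` through a linear
  isometry; smoothness from `Literature.Analysis.SpecialFunctions.contDiffAt_arg_of_mem_slitPlane`);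
* §2 the chart agrees with `polarAngle` modulo `2π` at every nonzero point;
* §3 **the near-field jets**: for a `C⁴` radius `r` with `r θ = u > 0`, curve jets `‖γ^{(i)}(θ)‖ ≤ D i` (`γ = toLp ∘ (r·dir)`) and a
  displacement `‖w‖ ≤ δ < u/2`, with `ρ = u − δ`:
  `|∂ϑᵐ[Ψ_θ(γ ϑ − w)](θ) − δ_{m1}| ≤ ‖w‖·Λ_m`, `Λ₁ = D₁/ρ²`, `Λ₂ = D₂/ρ² + 2D₁²/ρ³`, `Λ₃ = D₃/ρ² + 6D₁D₂/ρ³ + 6D₁³/ρ⁴`,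
  `Λ₄ = D₄/ρ² + (6D₂² + 8D₁D₃)/ρ³ + 36D₁²D₂/ρ⁴ + 24D₁⁴/ρ⁵` (the undispaced angle is `ϑ` itself; the difference is `G_w ∘ γ` with
  `G_w = Ψ̃(· − w) − Ψ̃` for a bump-globalised chart `Ψ̃`, bounded by my structured chain rule `abs_iteratedDeriv_comp_le_bell` (p485980) and
  the mean-value inequality on `p ↦ DˡΨ̃(p)`);
* §4 the TRANSPORT of the argument: `|Ψ_θ(γ θ − w) − θ| ≤ |w₁cos θ − w₀sin θ|/(u − δ)` (only the tangential component moves the angle).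

References: BGM 2006 §2.4–2.5 [cite: BenfattoGiulianiMastropietro2006] for the objects; the calculus is folklore.  Proofs only; no definitions.
-/

noncomputable section

namespace Summit.HubbardSuperconductivity.HubbardSuperconductivity.Theorems.KLRegimeSplit

set_option linter.dupNamespace false -- summit = problem name (single-conjunct summit), D-0017

open Real Set Filter Metric Complex
open scoped Topology
open Literature.MathematicalPhysics.QuantumLattice Literature.MathematicalPhysics.QuantumLattice.BandSectorCounting
open Literature.Analysis.SpecialFunctions (contDiffAt_arg_of_mem_slitPlane)
open Summit.HubbardSuperconductivity.HubbardSuperconductivity.Theorems.PerturbedFermiCurve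

/-! ## §1 The rotated argument chart -/

section Chart

/-- The rotated complex coordinate `p ↦ (p₀ + ip₁)·e^{−iθ}` IS a linear isometry `Momentum ≃ₗᵢ[ℝ] ℂ`. -/
theorem exists_rotIsometry (θ : ℝ) :
    ∃ L : Momentum ≃ₗᵢ[ℝ] ℂ, ∀ p : Momentum, L p = momToComplex (WithLp.ofLp p) * cexp (-(θ : ℂ) * I) := by
  refine ⟨Complex.orthonormalBasisOneI.repr.symm.trans (rotation (Circle.exp (-θ))), fun p => ?_⟩
  rw [LinearIsometryEquiv.trans_apply, rotation_apply, Circle.coe_exp, Complex.orthonormalBasisOneI_repr_symm_apply]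
  have : momToComplex (WithLp.ofLp p) = ↑(p.ofLp 0) + ↑(p.ofLp 1) * I := by
    apply Complex.ext <;> simp
  rw [this]; push_cast; ring

/-- Real part of the rotated coordinate: `Re((p₀ + ip₁)e^{−iθ}) = p₀ cos θ + p₁ sin θ` (the component of `p` along `dir θ`). -/
theorem re_momToComplex_mul_exp_neg (p : Fin 2 → ℝ) (θ : ℝ) :
    (momToComplex p * cexp (-(θ : ℂ) * I)).re = p 0 * Real.cos θ + p 1 * Real.sin θ := by
  have e : cexp (-(θ : ℂ) * I) = Complex.cos θ - Complex.sin θ * I := by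
    rw [show (-(θ : ℂ) * I) = (-(θ : ℂ)) * I by ring, Complex.exp_mul_I, Complex.cos_neg, Complex.sin_neg]; ring
  rw [e]
  simp [Complex.mul_re, Complex.cos_ofReal_re, Complex.sin_ofReal_re, Complex.cos_ofReal_im, Complex.sin_ofReal_im]

/-- Imaginary part of the rotated coordinate: `Im((p₀ + ip₁)e^{−iθ}) = p₁ cos θ − p₀ sin θ` (the TANGENTIAL component of `p`). -/
theorem im_momToComplex_mul_exp_neg (p : Fin 2 → ℝ) (θ : ℝ) :
    (momToComplex p * cexp (-(θ : ℂ) * I)).im = p 1 * Real.cos θ - p 0 * Real.sin θ := by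
  have e : cexp (-(θ : ℂ) * I) = Complex.cos θ - Complex.sin θ * I := by
    rw [show (-(θ : ℂ) * I) = (-(θ : ℂ)) * I by ring, Complex.exp_mul_I, Complex.cos_neg, Complex.sin_neg]; ring
  rw [e]
  simp [Complex.mul_im, Complex.cos_ofReal_re, Complex.sin_ofReal_re, Complex.cos_ofReal_im, Complex.sin_ofReal_im]
  ring

/-- On a ray: `(t·e^{iϑ})·e^{−iθ} = t·(cos(ϑ−θ) + i sin(ϑ−θ))`. -/
theorem momToComplex_smul_dir_mul_exp_neg (t ϑ θ : ℝ) :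
    momToComplex (t • dir ϑ) * cexp (-(θ : ℂ) * I) = (t : ℂ) * (Complex.cos ↑(ϑ - θ) + Complex.sin ↑(ϑ - θ) * I) := by
  rw [momToComplex_smul_dir, ← Complex.exp_mul_I, ← Complex.exp_mul_I, mul_assoc, ← Complex.exp_add]
  congr 2; push_cast; ring

/-- **The chart reads the angle of a ray**: `θ + arg((t·e^{iϑ})e^{−iθ}) = ϑ` for `t > 0` and `|ϑ − θ| < π`. -/
theorem rotArg_smul_dir {t : ℝ} (ht : 0 < t) {ϑ θ : ℝ} (hϑ : |ϑ - θ| < π) :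
    θ + arg (momToComplex (t • dir ϑ) * cexp (-(θ : ℂ) * I)) = ϑ := by
  rw [momToComplex_smul_dir_mul_exp_neg, Complex.arg_mul_cos_add_sin_mul_I ht ⟨by linarith [(abs_lt.1 hϑ).1], by
    linarith [(abs_lt.1 hϑ).2]⟩]
  ring

/-- **The chart is smooth on the open half-plane `p·dir θ > 0`.** -/
theorem contDiffAt_rotArg {θ : ℝ} {p : Momentum} (hp : 0 < WithLp.ofLp p 0 * Real.cos θ + WithLp.ofLp p 1 * Real.sin θ)
    {n : WithTop ℕ∞} :
    ContDiffAt ℝ n (fun q : Momentum => θ + arg (momToComplex (WithLp.ofLp q) * cexp (-(θ : ℂ) * I))) p := by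
  obtain ⟨L, hL⟩ := exists_rotIsometry θ
  have hz : L p ∈ slitPlane := by
    rw [Complex.mem_slitPlane_iff, hL, re_momToComplex_mul_exp_neg]; exact Or.inl hp
  have h1 : ContDiffAt ℝ n (fun q : Momentum => arg (L q)) p :=
    (contDiffAt_arg_of_mem_slitPlane hz).comp p L.contDiff.contDiffAt
  have e : (fun q : Momentum => θ + arg (momToComplex (WithLp.ofLp q) * cexp (-(θ : ℂ) * I))) =
      fun q => θ + arg (L q) := by funext q; rw [hL]
  rw [e]
  exact contDiffAt_const.add h1

/-- **Derivative norms of the chart**: `‖D^{l+1}Ψ_θ(p)‖ ≤ l!/‖p‖^{l+1}` on the half-plane `p·dir θ > 0`. -/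
theorem norm_iteratedFDeriv_rotArg_le {θ : ℝ} {p : Momentum} (hp : 0 < WithLp.ofLp p 0 * Real.cos θ + WithLp.ofLp p 1 * Real.sin θ)
    (l : ℕ) :
    ‖iteratedFDeriv ℝ (l + 1) (fun q : Momentum => θ + arg (momToComplex (WithLp.ofLp q) * cexp (-(θ : ℂ) * I))) p‖ ≤
      (l.factorial : ℝ) / ‖p‖ ^ (l + 1) := by
  obtain ⟨L, hL⟩ := exists_rotIsometry θ
  have hz : L p ∈ slitPlane := by
    rw [Complex.mem_slitPlane_iff, hL, re_momToComplex_mul_exp_neg]; exact Or.inl hp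
  have e : (fun q : Momentum => θ + arg (momToComplex (WithLp.ofLp q) * cexp (-(θ : ℂ) * I))) =
      (fun z : ℂ => θ + arg z) ∘ L := by funext q; simp [hL]
  rw [e, LinearIsometryEquiv.norm_iteratedFDeriv_comp_right L (fun z : ℂ => θ + arg z) p (l + 1)]
  -- the constant drops out of every derivative of positive order
  have hca : ContDiffAt ℝ ((l + 1 : ℕ) : WithTop ℕ∞) (fun _ : ℂ => θ) (L p) := contDiffAt_const
  have haa : ContDiffAt ℝ ((l + 1 : ℕ) : WithTop ℕ∞) arg (L p) := contDiffAt_arg_of_mem_slitPlane hz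
  have hadd : iteratedFDeriv ℝ (l + 1) (fun z : ℂ => θ + arg z) (L p) = iteratedFDeriv ℝ (l + 1) arg (L p) := by
    have h := iteratedFDeriv_add_apply (i := l + 1) hca haa
    rw [show ((fun _ : ℂ => θ) + arg) = fun z : ℂ => θ + arg z from rfl] at h
    rw [h, iteratedFDeriv_succ_const, Pi.zero_apply, zero_add]
  rw [hadd, ← L.norm_map p]
  exact norm_iteratedFDeriv_arg_le hz l

/-- **The chart is the polar angle modulo `2π`**: `θ + arg((q₀+iq₁)e^{−iθ}) = polarAngle q + 2πk` at every `q` off the origin. -/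
theorem exists_rotArg_eq_polarAngle_add (θ : ℝ) {q : Fin 2 → ℝ} (hq : momToComplex q ≠ 0) :
    ∃ k : ℤ, θ + arg (momToComplex q * cexp (-(θ : ℂ) * I)) = polarAngle q + k * (2 * π) := by
  have he : cexp (-(θ : ℂ) * I) ≠ 0 := Complex.exp_ne_zero _
  have hang : ((θ + arg (momToComplex q * cexp (-(θ : ℂ) * I)) : ℝ) : Real.Angle) = (polarAngle q : Real.Angle) := by
    rw [Real.Angle.coe_add, Complex.arg_mul_coe_angle hq he, show (-(θ : ℂ) * I) = ((-θ : ℝ) : ℂ) * I by push_cast; ring,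
      Complex.arg_exp_mul_I, Real.Angle.coe_toIocMod, polarAngle, Real.Angle.coe_neg]
    abel
  obtain ⟨k, hk⟩ := Real.Angle.angle_eq_iff_two_pi_dvd_sub.1 hang
  exact ⟨k, by linarith⟩

end Chart

/-! ## §3 The near-field jets of the displaced angle through the chart -/

section Near

/-- `‖certCurve r ϑ‖ = |r ϑ|`. -/
theorem norm_certCurve (r : ℝ → ℝ) (ϑ : ℝ) : ‖certCurve r ϑ‖ = |r ϑ| := by
  rw [certCurve, EuclideanSpace.norm_eq, Fin.sum_univ_two]
  simp only [Pi.smul_apply, smul_eq_mul, Real.norm_eq_abs, sq_abs, dir, Matrix.cons_val_zero,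
    Matrix.cons_val_one, Matrix.cons_val_fin_one]
  rw [show (r ϑ * Real.cos ϑ) ^ 2 + (r ϑ * Real.sin ϑ) ^ 2 = (r ϑ) ^ 2 by nlinarith [Real.cos_sq_add_sin_sq ϑ],
    Real.sqrt_sq_eq_abs]

/-- The rotated coordinate of the base point is the real number `r θ`. -/
theorem momToComplex_certCurve_mul_exp_neg (r : ℝ → ℝ) (θ : ℝ) :
    momToComplex (WithLp.ofLp (certCurve r θ)) * cexp (-(θ : ℂ) * I) = (r θ : ℂ) := by
  rw [certCurve, WithLp.ofLp_toLp, momToComplex_smul_dir_mul_exp_neg, sub_self]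
  push_cast; simp

/-- `momToComplex ∘ ofLp` is additive. -/
theorem momToComplex_ofLp_sub (p q : Momentum) :
    momToComplex (WithLp.ofLp (p - q)) = momToComplex (WithLp.ofLp p) - momToComplex (WithLp.ofLp q) := by
  apply Complex.ext <;> simp

/-- **Half-plane margin**: `p·dir θ ≥ r θ − ‖p − certCurve r θ‖` — so the ball of radius `r θ` around the base point lies in the chart's
half-plane. -/
theorem dirComponent_ge (r : ℝ → ℝ) (θ : ℝ) (p : Momentum) :
    r θ - ‖p - certCurve r θ‖ ≤ WithLp.ofLp p 0 * Real.cos θ + WithLp.ofLp p 1 * Real.sin θ := by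
  obtain ⟨L, hL⟩ := exists_rotIsometry θ
  have h1 : (L p).re = WithLp.ofLp p 0 * Real.cos θ + WithLp.ofLp p 1 * Real.sin θ := by
    rw [hL, re_momToComplex_mul_exp_neg]
  have h2 : (L (certCurve r θ)).re = r θ := by
    rw [hL, momToComplex_certCurve_mul_exp_neg, Complex.ofReal_re]
  have h3 : |(L (p - certCurve r θ)).re| ≤ ‖p - certCurve r θ‖ := by
    rw [← L.norm_map (p - certCurve r θ)]; exact Complex.abs_re_le_norm _
  rw [map_sub, Complex.sub_re, h1, h2] at h3
  linarith [(abs_le.1 h3).1]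

/-- Points within `δ` of the base point have norm `≥ r θ − δ`. -/
theorem norm_ge_of_near (r : ℝ → ℝ) (θ : ℝ) {p : Momentum} {δ : ℝ} (hp : ‖p - certCurve r θ‖ ≤ δ) (hr : 0 ≤ r θ) :
    r θ - δ ≤ ‖p‖ := by
  have h := norm_sub_norm_le (certCurve r θ) p
  rw [norm_certCurve, abs_of_nonneg hr, norm_sub_rev] at h
  linarith

variable {r : ℝ → ℝ} (hr : ContDiff ℝ 4 r) {θ : ℝ} (hu : 0 < r θ)
include hr hu

/-- **The undisplaced angle is the parameter itself near the base angle**: `Ψ_θ(certCurve r ϑ) = ϑ` for `ϑ` near `θ`. -/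
theorem rotArg_certCurve_eventuallyEq :
    (fun ϑ : ℝ => θ + arg (momToComplex (WithLp.ofLp (certCurve r ϑ)) * cexp (-(θ : ℂ) * I))) =ᶠ[𝓝 θ] fun ϑ => ϑ := by
  have hpos : ∀ᶠ ϑ in 𝓝 θ, 0 < r ϑ := hr.continuous.continuousAt.eventually (lt_mem_nhds hu)
  have hnear : ∀ᶠ ϑ in 𝓝 θ, |ϑ - θ| < π := by
    have : Metric.ball θ π ∈ 𝓝 θ := Metric.ball_mem_nhds θ Real.pi_pos
    filter_upwards [this] with ϑ hϑ
    rwa [Metric.mem_ball, Real.dist_eq] at hϑ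
  filter_upwards [hpos, hnear] with ϑ h1 h2
  rw [certCurve, WithLp.ofLp_toLp]
  exact rotArg_smul_dir h1 h2

/-- **Jets of the undisplaced angle**: `∂ϑᵐ[Ψ_θ(certCurve r ϑ)](θ) = δ_{m1}` for `m ≥ 1`. -/
theorem iteratedDeriv_rotArg_certCurve {m : ℕ} (hm : 1 ≤ m) :
    iteratedDeriv m (fun ϑ : ℝ => θ + arg (momToComplex (WithLp.ofLp (certCurve r ϑ)) * cexp (-(θ : ℂ) * I))) θ =
      if m = 1 then 1 else 0 := by
  rw [Filter.EventuallyEq.iteratedDeriv_eq m (rotArg_certCurve_eventuallyEq hr hu),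
    show (fun ϑ : ℝ => ϑ) = id from rfl, iteratedDeriv_id, if_neg (by omega)]

/-- **THE NEAR-FIELD JETS OF THE DISPLACED ANGLE (through the chart).**  For a `C⁴` radius with `r θ = u > 0`, a displacement
`‖w‖ ≤ δ` with `δ < u/2`, `ρ = u − δ`, and curve jets `‖(certCurve r)^{(i)}(θ)‖ ≤ D i` (`1 ≤ i ≤ 4`):
`|∂¹α_w(θ) − 1| ≤ ‖w‖·D₁/ρ²`, `|∂²α_w(θ)| ≤ ‖w‖·(2D₁²/ρ³ + D₂/ρ²)`, `|∂³α_w(θ)| ≤ ‖w‖·(6D₁³/ρ⁴ + 6D₁D₂/ρ³ + D₃/ρ²)`,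
`|∂⁴α_w(θ)| ≤ ‖w‖·(24D₁⁴/ρ⁵ + 36D₁²D₂/ρ⁴ + (6D₂² + 8D₁D₃)/ρ³ + D₄/ρ²)`, where `α_w(ϑ) = Ψ_θ(certCurve r ϑ − w)`. -/
theorem rotArg_displaced_jets_near {δ : ℝ} (hδ : 0 ≤ δ) (hδu : δ < r θ / 2) {w : Momentum} (hw : ‖w‖ ≤ δ) {D : ℕ → ℝ}
    (hD : ∀ i, 1 ≤ i → i ≤ 4 → ‖iteratedDeriv i (certCurve r) θ‖ ≤ D i) :
    |iteratedDeriv 1 (fun ϑ : ℝ => θ + arg (momToComplex (WithLp.ofLp (certCurve r ϑ - w)) * cexp (-(θ : ℂ) * I))) θ - 1| ≤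
        ‖w‖ * (D 1 / (r θ - δ) ^ 2) ∧
      |iteratedDeriv 2 (fun ϑ : ℝ => θ + arg (momToComplex (WithLp.ofLp (certCurve r ϑ - w)) * cexp (-(θ : ℂ) * I))) θ| ≤
        ‖w‖ * (2 * D 1 ^ 2 / (r θ - δ) ^ 3 + D 2 / (r θ - δ) ^ 2) ∧
      |iteratedDeriv 3 (fun ϑ : ℝ => θ + arg (momToComplex (WithLp.ofLp (certCurve r ϑ - w)) * cexp (-(θ : ℂ) * I))) θ| ≤
        ‖w‖ * (6 * D 1 ^ 3 / (r θ - δ) ^ 4 + 6 * D 1 * D 2 / (r θ - δ) ^ 3 + D 3 / (r θ - δ) ^ 2) ∧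
      |iteratedDeriv 4 (fun ϑ : ℝ => θ + arg (momToComplex (WithLp.ofLp (certCurve r ϑ - w)) * cexp (-(θ : ℂ) * I))) θ| ≤
        ‖w‖ * (24 * D 1 ^ 4 / (r θ - δ) ^ 5 + 36 * D 1 ^ 2 * D 2 / (r θ - δ) ^ 4 +
          (6 * D 2 ^ 2 + 8 * D 1 * D 3) / (r θ - δ) ^ 3 + D 4 / (r θ - δ) ^ 2) := by
  set u := r θ with hudef
  set ρ := u - δ with hρdef
  have hρ : 0 < ρ := by rw [hρdef]; linarith
  set c : Momentum := certCurve r θ with hcdef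
  set Ψ : Momentum → ℝ := fun q => θ + arg (momToComplex (WithLp.ofLp q) * cexp (-(θ : ℂ) * I)) with hΨdef
  -- the bump-globalised chart
  let φ : ContDiffBump c := ⟨u / 2, 3 * u / 4, by positivity, by linarith⟩
  set F : Momentum → ℝ := fun q => φ q * Ψ q with hFdef
  have hhalf : ∀ q : Momentum, ‖q - c‖ < u → 0 < WithLp.ofLp q 0 * Real.cos θ + WithLp.ofLp q 1 * Real.sin θ := fun q hq => by
    have := dirComponent_ge r θ q; rw [← hcdef] at this; linarith
  have hFΨ : ∀ q : Momentum, ‖q - c‖ < u / 2 → F =ᶠ[𝓝 q] Ψ := fun q hq => by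
    have hball : Metric.ball c (u / 2) ∈ 𝓝 q := Metric.isOpen_ball.mem_nhds (by rwa [Metric.mem_ball, dist_eq_norm])
    filter_upwards [hball] with q' hq'
    have h1 : (φ : Momentum → ℝ) q' = 1 := φ.one_of_mem_closedBall (Metric.ball_subset_closedBall hq')
    simp only [hFdef, h1, one_mul]
  have hFC : ∀ n : ℕ, ContDiff ℝ n F := fun n => by
    refine contDiff_iff_contDiffAt.2 fun q => ?_
    by_cases hq : ‖q - c‖ < u
    · exact ((φ.contDiff (n := n)).contDiffAt).mul (contDiffAt_rotArg (hhalf q hq))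
    · have hnot : q ∉ tsupport (φ : Momentum → ℝ) := by
        intro hmem
        rw [φ.tsupport_eq, Metric.mem_closedBall, dist_eq_norm] at hmem
        exact hq (lt_of_le_of_lt hmem (by show 3 * u / 4 < u; linarith))
      have hev : (φ : Momentum → ℝ) =ᶠ[𝓝 q] 0 := notMem_tsupport_iff_eventuallyEq.1 hnot
      have hF0 : F =ᶠ[𝓝 q] fun _ => 0 := by
        filter_upwards [hev] with q' hq'
        simp only [hFdef, hq', Pi.zero_apply, zero_mul]
      exact (contDiffAt_const.congr_of_eventuallyEq hF0)
  -- derivative norms of `F` on the closed `δ`-ball: `‖D^{k+1}F‖ ≤ k!/ρ^{k+1}`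
  have hFder : ∀ k : ℕ, ∀ q ∈ Metric.closedBall c δ, ‖fderiv ℝ (iteratedFDeriv ℝ k F) q‖ ≤ (k.factorial : ℝ) / ρ ^ (k + 1) := by
    intro k q hq
    rw [Metric.mem_closedBall, dist_eq_norm] at hq
    have hq2 : ‖q - c‖ < u / 2 := lt_of_le_of_lt hq hδu
    rw [norm_fderiv_iteratedFDeriv, ((hFΨ q hq2).iteratedFDeriv ℝ (k + 1)).eq_of_nhds]
    have hqn : ρ ≤ ‖q‖ := by
      have := norm_ge_of_near r θ hq hu.le; rw [hρdef]; exact this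
    calc ‖iteratedFDeriv ℝ (k + 1) Ψ q‖ ≤ (k.factorial : ℝ) / ‖q‖ ^ (k + 1) :=
          norm_iteratedFDeriv_rotArg_le (hhalf q (by linarith)) k
      _ ≤ (k.factorial : ℝ) / ρ ^ (k + 1) := by
          apply div_le_div_of_nonneg_left (by positivity) (by positivity)
          exact pow_le_pow_left₀ hρ.le hqn _
  -- the mean-value inequality for `p ↦ DᵏF(p)` between `c` and `c − w`
  have hMVT : ∀ k : ℕ, ‖iteratedFDeriv ℝ k F (c - w) - iteratedFDeriv ℝ k F c‖ ≤ (k.factorial : ℝ) / ρ ^ (k + 1) * ‖w‖ := by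
    intro k
    have hdiff : ∀ q ∈ Metric.closedBall c δ, DifferentiableAt ℝ (iteratedFDeriv ℝ k F) q := fun q _ =>
      ((hFC (k + 1)).differentiable_iteratedFDeriv (by exact_mod_cast Nat.lt_succ_self k)) q
    have h := Convex.norm_image_sub_le_of_norm_fderiv_le hdiff (hFder k) (convex_closedBall c δ)
      (Metric.mem_closedBall_self hδ) (y := c - w) (by rw [Metric.mem_closedBall, dist_eq_norm]; simpa using hw)
    simpa using h
  -- the difference function `G = F(· − w) − F` and its sizes at `c`
  set G : Momentum → ℝ := fun q => F (q - w) - F q with hGdef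
  have hGC : ContDiff ℝ 4 G := ((hFC 4).comp (contDiff_id.sub contDiff_const)).sub (hFC 4)
  have hGsize : ∀ k, 1 ≤ k → k ≤ 4 → ‖iteratedFDeriv ℝ k G (certCurve r θ)‖ ≤ ‖w‖ * (k.factorial : ℝ) / ρ ^ (k + 1) := by
    intro k _ _
    have h1 : ContDiffAt ℝ (k : ℕ) (fun q : Momentum => F (q - w)) c :=
      ((hFC k).comp (contDiff_id.sub contDiff_const)).contDiffAt
    have h2 : ContDiffAt ℝ (k : ℕ) F c := (hFC k).contDiffAt
    have e : iteratedFDeriv ℝ k G c = iteratedFDeriv ℝ k F (c - w) - iteratedFDeriv ℝ k F c := by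
      rw [show G = (fun q : Momentum => F (q - w)) - F from rfl, iteratedFDeriv_sub_apply h1 h2, iteratedFDeriv_comp_sub]
    rw [← hcdef, e]
    calc _ ≤ (k.factorial : ℝ) / ρ ^ (k + 1) * ‖w‖ := hMVT k
      _ = ‖w‖ * (k.factorial : ℝ) / ρ ^ (k + 1) := by ring
  -- the two curve compositions agree with `F ∘ (γ − w)` and `F ∘ γ` near `θ`
  have hγC : ContDiff ℝ 4 (certCurve r) := contDiff_certCurve hr
  have hγnear : ∀ᶠ ϑ in 𝓝 θ, ‖certCurve r ϑ - c‖ < u / 2 - δ := by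
    have hcont : ContinuousAt (fun ϑ => ‖certCurve r ϑ - c‖) θ :=
      ((hγC.continuous.sub continuous_const).norm).continuousAt
    have h0 : ‖certCurve r θ - c‖ < u / 2 - δ := by rw [hcdef, sub_self, norm_zero]; linarith
    exact hcont.eventually (gt_mem_nhds h0)
  have hαw : (fun ϑ : ℝ => Ψ (certCurve r ϑ - w)) =ᶠ[𝓝 θ] fun ϑ => F (certCurve r ϑ - w) := by
    filter_upwards [hγnear] with ϑ hϑ
    have hq : ‖certCurve r ϑ - w - c‖ < u / 2 := by
      calc ‖certCurve r ϑ - w - c‖ = ‖(certCurve r ϑ - c) - w‖ := by abel_nf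
        _ ≤ ‖certCurve r ϑ - c‖ + ‖w‖ := norm_sub_le _ _
        _ < u / 2 := by linarith
    exact ((hFΨ _ hq).eq_of_nhds).symm
  have hα0 : (fun ϑ : ℝ => Ψ (certCurve r ϑ)) =ᶠ[𝓝 θ] fun ϑ => F (certCurve r ϑ) := by
    filter_upwards [hγnear] with ϑ hϑ
    exact ((hFΨ _ (by linarith)).eq_of_nhds).symm
  -- hence `∂ᵐα_w − ∂ᵐα_0 = ∂ᵐ(G ∘ γ)` at `θ`
  have hdiffm : ∀ m ≤ 4, iteratedDeriv m (fun ϑ : ℝ => Ψ (certCurve r ϑ - w)) θ -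
      iteratedDeriv m (fun ϑ : ℝ => Ψ (certCurve r ϑ)) θ = iteratedDeriv m (G ∘ certCurve r) θ := by
    intro m hm
    rw [Filter.EventuallyEq.iteratedDeriv_eq m hαw, Filter.EventuallyEq.iteratedDeriv_eq m hα0]
    have h1 : ContDiffAt ℝ (m : ℕ) (fun ϑ : ℝ => F (certCurve r ϑ - w)) θ :=
      (((hFC m).comp ((hγC.of_le (by exact_mod_cast hm)).sub contDiff_const))).contDiffAt
    have h2 : ContDiffAt ℝ (m : ℕ) (fun ϑ : ℝ => F (certCurve r ϑ)) θ :=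
      ((hFC m).comp (hγC.of_le (by exact_mod_cast hm))).contDiffAt
    rw [← iteratedDeriv_fun_sub h1 h2]
    rfl
  -- the undisplaced jets
  have hj0 : ∀ m, 1 ≤ m → iteratedDeriv m (fun ϑ : ℝ => Ψ (certCurve r ϑ)) θ = if m = 1 then 1 else 0 :=
    fun m hm => iteratedDeriv_rotArg_certCurve hr hu hm
  -- the Bell bound for `G ∘ γ`
  obtain ⟨b1, b2, b3, b4⟩ := abs_iteratedDeriv_comp_le_bell hGC hγC (θ := θ)
    (M := fun k => ‖w‖ * (k.factorial : ℝ) / ρ ^ (k + 1)) (D := D) hGsize hD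
  simp only [Nat.factorial, Nat.succ_eq_add_one, Nat.cast_one, Nat.cast_mul, mul_one, zero_add] at b1 b2 b3 b4
  refine ⟨?_, ?_, ?_, ?_⟩
  · have e := hdiffm 1 (by norm_num); rw [hj0 1 le_rfl, if_pos rfl] at e
    rw [e]; refine b1.trans (le_of_eq ?_); push_cast; ring
  · have e := hdiffm 2 (by norm_num); rw [hj0 2 (by norm_num), if_neg (by norm_num), sub_zero] at e
    rw [e]; refine b2.trans (le_of_eq ?_); push_cast; ring
  · have e := hdiffm 3 (by norm_num); rw [hj0 3 (by norm_num), if_neg (by norm_num), sub_zero] at e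
    rw [e]; refine b3.trans (le_of_eq ?_); push_cast; ring
  · have e := hdiffm 4 (by norm_num); rw [hj0 4 (by norm_num), if_neg (by norm_num), sub_zero] at e
    rw [e]; refine b4.trans (le_of_eq ?_); push_cast; ring

omit hu in
/-- **The displaced angle through the chart is `C⁴` at the base angle** (`‖w‖ < r θ`). -/
theorem contDiffAt_rotArg_displaced {w : Momentum} (hw : ‖w‖ < r θ) :
    ContDiffAt ℝ 4 (fun ϑ : ℝ => θ + arg (momToComplex (WithLp.ofLp (certCurve r ϑ - w)) * cexp (-(θ : ℂ) * I))) θ := by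
  have hq : 0 < WithLp.ofLp (certCurve r θ - w) 0 * Real.cos θ + WithLp.ofLp (certCurve r θ - w) 1 * Real.sin θ := by
    have := dirComponent_ge r θ (certCurve r θ - w)
    rw [show certCurve r θ - w - certCurve r θ = -w by abel, norm_neg] at this
    linarith
  have h2 : ContDiffAt ℝ 4 (fun ϑ : ℝ => certCurve r ϑ - w) θ := ((contDiff_certCurve hr).sub contDiff_const).contDiffAt
  exact ContDiffAt.comp (g := fun q : Momentum => θ + arg (momToComplex (WithLp.ofLp q) * cexp (-(θ : ℂ) * I)))
    (f := fun ϑ : ℝ => certCurve r ϑ - w) θ (contDiffAt_rotArg (n := 4) hq) h2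

end Near

/-! ## §4 The transport of the argument -/

section Transport

/-- `|x| ≤ |tan x|` for `|x| < π/2`. -/
theorem abs_le_abs_tan {x : ℝ} (hx : |x| < π / 2) : |x| ≤ |Real.tan x| := by
  rcases le_or_gt 0 x with h | h
  · rw [abs_of_nonneg h] at hx ⊢
    exact (Real.le_tan h hx).trans (le_abs_self _)
  · rw [abs_of_neg h] at hx ⊢
    have := Real.le_tan (neg_nonneg.2 h.le) hx
    rw [Real.tan_neg] at this
    exact this.trans (neg_le_abs _)

/-- **THE TRANSPORT OF THE ARGUMENT**: for `‖w‖ ≤ δ < r θ`, the chart angle of the displaced base point moves by at most the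
TANGENTIAL component of `w` over `r θ − δ`:  `|Ψ_θ(certCurve r θ − w) − θ| ≤ |w₁ cos θ − w₀ sin θ|/(r θ − δ)`, and the difference lies in
`(−π/2, π/2)` (so it is its own representative modulo `2π`). -/
theorem abs_rotArg_displaced_sub_le {r : ℝ → ℝ} {θ δ : ℝ} (hδ : δ < r θ) {w : Momentum} (hw : ‖w‖ ≤ δ) :
    |θ + arg (momToComplex (WithLp.ofLp (certCurve r θ - w)) * cexp (-(θ : ℂ) * I)) - θ| ≤
        |WithLp.ofLp w 1 * Real.cos θ - WithLp.ofLp w 0 * Real.sin θ| / (r θ - δ) ∧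
      |θ + arg (momToComplex (WithLp.ofLp (certCurve r θ - w)) * cexp (-(θ : ℂ) * I)) - θ| < π / 2 := by
  set ζ := momToComplex (WithLp.ofLp (certCurve r θ - w)) * cexp (-(θ : ℂ) * I) with hζ
  set ω := momToComplex (WithLp.ofLp w) * cexp (-(θ : ℂ) * I) with hω
  have hζω : ζ = (r θ : ℂ) - ω := by
    rw [hζ, momToComplex_ofLp_sub, sub_mul, momToComplex_certCurve_mul_exp_neg]
  have hωn : ‖ω‖ = ‖w‖ := by
    obtain ⟨L, hL⟩ := exists_rotIsometry θ
    rw [hω, ← hL, L.norm_map]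
  have hre : r θ - δ ≤ ζ.re := by
    rw [hζω, Complex.sub_re, Complex.ofReal_re]
    linarith [(abs_le.1 ((Complex.abs_re_le_norm ω).trans (hωn.le.trans hw))).2]
  have hre0 : 0 < ζ.re := lt_of_lt_of_le (by linarith) hre
  have him : ζ.im = -(WithLp.ofLp w 1 * Real.cos θ - WithLp.ofLp w 0 * Real.sin θ) := by
    rw [hζω, Complex.sub_im, Complex.ofReal_im, hω, im_momToComplex_mul_exp_neg]; ring
  have harg : |arg ζ| < π / 2 := Complex.abs_arg_lt_pi_div_two_iff.2 (Or.inl hre0)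
  rw [add_sub_cancel_left]
  refine ⟨?_, harg⟩
  calc |arg ζ| ≤ |Real.tan (arg ζ)| := abs_le_abs_tan harg
    _ = |ζ.im| / ζ.re := by rw [Complex.tan_arg, abs_div, abs_of_pos hre0]
    _ ≤ |WithLp.ofLp w 1 * Real.cos θ - WithLp.ofLp w 0 * Real.sin θ| / (r θ - δ) := by
        rw [him, abs_neg]
        exact div_le_div_of_nonneg_left (abs_nonneg _) (by linarith) hre

end Transport

end Summit.HubbardSuperconductivity.HubbardSuperconductivity.Theorems.KLRegimeSplit

end
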